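import Literature.Probability.LatticeModels.LocalPerturbationClusterExpansion
import HarnessLib

/-!
# Pinned connected-subfamily sums under the Kotecký–Preiss criterion (E′-COMB)

Helper file for crux `Summit.QuantumFields.YangMills.Theses.UnitScaleTilt.FluctuationComparisonRegPrIntL`
(item stmt-QuantumFields-20520), `--supports`, hypothesis form, **definition-free**.  It proves, token
for token, the `Prop` `PinnedConnectedFamilyBound` typed by the ideator (ym-r3-idea-1 g19) in
`Cruxes/FluctuationComparisonRegPrIntL/EPrimeSketch.lean` — item E′-COMB of crux idea `neumann-frd-step`
(card `Ideas/neumann-frd-step.md` v1.2): the combinatorial half of the WEIGHTED local-perturbation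
engine E′ (`WeightedLocalPerturbationKP`, companion file), needed to iterate the tree's engine
`Literature.Probability.LatticeModels.LocalPerturbation{PolymerGas,ClusterExpansion}` across the
finite-range sub-fields of the Neumann decomposition (`…S2BetaNeumannFRDPieces` / `…S2BetaNeumannFRD`).

**Mathematics.**  `P` a type of "polymers" with a reflexive symmetric incompatibility `inc`,
weights `w ≥ 0`, a size function `a`, and a finite volume `Λ` on which the real Kotecký–Preiss
criterion holds: `∀ γ ∈ Λ, ∑_{γ' ∈ Λ, γ' ι γ} w γ' e^{a γ'} ≤ a γ`.  Write
`S(Λ, γ₀) := ∑_{𝒦 ⊆ Λ inc-connected, γ₀ ∈ 𝒦} ∏_{γ ∈ 𝒦} w γ` (the pinned "animal" sum over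
`rconnSubsets inc Λ`).  THEN `S(Λ, γ₀) ≤ w γ₀ · e^{a γ₀}` for every `γ₀ ∈ Λ` (`pinned_connected_sum_le`,
and by text `pinnedConnectedFamilyBound`).

PROOF WITHOUT THE `1/m!` BOOKKEEPING (§2 `pinned_connected_sum_le_exp`): removing `γ₀` from a connected
`𝒦 ∋ γ₀` leaves the `inc`-components of `𝒦.erase γ₀` (tree ✓`rcomponents`, ✓`biUnion_rcomponents`,
✓`isRConnected_rcomponent`, ✓`eq_of_touches_rcomponent`), a family of pairwise disjoint connected
subsets of `Λ' := Λ.erase γ₀` EACH CONTAINING A NEIGHBOUR OF `γ₀` (first exit of a chain to `γ₀`,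
`exists_inc_of_mem_rcomponents_erase`); `𝒦 ↦ components` is injective (the union recovers `𝒦.erase γ₀`),
so with `A := {D ⊆ Λ' connected | D ∋ some neighbour of γ₀}` and `W D := ∏_D w ≥ 0`:
`S(Λ,γ₀) ≤ w γ₀ · ∑_{ℱ ⊆ A} ∏_{D ∈ ℱ} W D = w γ₀ · ∏_{D ∈ A} (1 + W D) ≤ w γ₀ · exp (∑_{D ∈ A} W D)
≤ w γ₀ · exp (∑_{γ ∈ Λ', γ ι γ₀} S(Λ', γ))` (`Finset.prod_one_add`, `Real.add_one_le_exp`, a neighbour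
count ≥ 1 on `A`).  §3 closes by induction on `#Λ`: the criterion is inherited by `Λ'` (non-negative
terms), the inductive bound gives `∑_{γ ι γ₀} S(Λ',γ) ≤ ∑_{γ ι γ₀} w γ e^{a γ} ≤ a γ₀`.

Sources: [cite: KoteckyPreiss1986, §2 (the pinned induction)]; [cite: FriedliVelenik2017, §5.4];
the use is [cite: BauerschmidtBrydgesSlade2019, §3.3] (finite-range steps).

HONEST LABEL.  Generic combinatorics supplying NO estimate of the lane: not E′, not GAS₁, not REP; it
proves no stub; nothing of `FluctuationComparisonRegPrIntL` (20520) is proved here.  Rung R3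
(YM₃ = SU(2) on T³) is NOT d = 4, NOT infinite volume, NOT a mass gap, NOT the Clay problem.
-/

namespace Summit.QuantumFields.YangMills.Theorems.FluctuationComparisonRegPrIntLS2BetaEPrimeComb

open Finset Literature.Probability.LatticeModels
open scoped BigOperators

variable {P : Type*} [DecidableEq P] {inc : P → P → Prop}

/-! ## §1 Two counting lemmas -/

/-- COVERING LEMMA: if every `x ∈ F ⊆ G` has a witness `i ∈ I` with `p i x`, and `T ≥ 0` on `G`,
then `∑_{x ∈ F} T x ≤ ∑_{i ∈ I} ∑_{x ∈ G, p i x} T x` (each `x ∈ F` is counted at least once on the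
right, the other terms are non-negative). -/
theorem sum_le_sum_sum_filter_of_cover {α β : Type*} [DecidableEq α] (F G : Finset α) (I : Finset β)
    (p : β → α → Prop) [∀ i, DecidablePred (p i)] (T : α → ℝ) (hT : ∀ x ∈ G, 0 ≤ T x)
    (hFG : F ⊆ G) (hcov : ∀ x ∈ F, ∃ i ∈ I, p i x) :
    ∑ x ∈ F, T x ≤ ∑ i ∈ I, ∑ x ∈ G with p i x, T x := by
  have hswap : ∑ i ∈ I, ∑ x ∈ G with p i x, T x =
      ∑ x ∈ G, ∑ i ∈ I, (if p i x then T x else 0) := by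
    simp_rw [Finset.sum_filter]
    exact Finset.sum_comm
  rw [hswap, ← Finset.sum_filter_add_sum_filter_not G (· ∈ F)]
  have hGF : G.filter (· ∈ F) = F := by
    ext x
    simp only [Finset.mem_filter, and_iff_right_iff_imp]
    exact fun hx => hFG hx
  rw [hGF]
  have h1 : ∑ x ∈ F, T x ≤ ∑ x ∈ F, ∑ i ∈ I, (if p i x then T x else 0) := by
    refine Finset.sum_le_sum fun x hx => ?_
    obtain ⟨i, hi, hpx⟩ := hcov x hx
    have hTx : 0 ≤ T x := hT x (hFG hx)
    calc T x = (if p i x then T x else 0) := by rw [if_pos hpx]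
      _ ≤ ∑ j ∈ I, (if p j x then T x else 0) :=
          Finset.single_le_sum (f := fun j => if p j x then T x else 0)
            (fun j _ => by split_ifs <;> simp [hTx]) hi
  have h2 : 0 ≤ ∑ x ∈ G with ¬ x ∈ F, ∑ i ∈ I, (if p i x then T x else 0) :=
    Finset.sum_nonneg fun x hx => Finset.sum_nonneg fun i _ => by
      have := hT x (Finset.mem_filter.1 hx).1
      split_ifs <;> simp [this]
  linarith

/-- `∏_{i ∈ s} (1 + f i) ≤ exp (∑_{i ∈ s} f i)` for `f ≥ 0`. -/
theorem prod_one_add_le_exp_sum {α : Type*} (s : Finset α) (f : α → ℝ) (hf : ∀ i ∈ s, 0 ≤ f i) :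
    ∏ i ∈ s, (1 + f i) ≤ Real.exp (∑ i ∈ s, f i) := by
  rw [Real.exp_sum]
  refine Finset.prod_le_prod (fun i hi => by linarith [hf i hi]) fun i _ => ?_
  have := Real.add_one_le_exp (f i)
  linarith

/-! ## §2 The one-step bound: remove the pin, pass to components -/

omit [DecidableEq P] in
/-- Weight products are non-negative for non-negative weights. -/
theorem prod_weight_nonneg {w : P → ℝ} (hw : ∀ γ, 0 ≤ w γ) (D : Finset P) : 0 ≤ ∏ γ ∈ D, w γ :=
  Finset.prod_nonneg fun γ _ => hw γ

/-- Distinct `inc`-components of `Q` are disjoint (they do not even touch). -/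
theorem pairwiseDisjoint_rcomponents (hsymm : ∀ γ γ', inc γ γ' → inc γ' γ) (Q : Finset P) :
    (↑(rcomponents inc Q) : Set (Finset P)).PairwiseDisjoint id := by
  intro D₁ hD₁ D₂ hD₂ hne
  obtain ⟨p₁, -, rfl⟩ := mem_rcomponents_iff.1 (Finset.mem_coe.1 hD₁)
  obtain ⟨p₂, -, rfl⟩ := mem_rcomponents_iff.1 (Finset.mem_coe.1 hD₂)
  rw [Function.onFun, id, id, Finset.disjoint_left]
  intro x hx1 hx2
  exact hne (eq_of_touches_rcomponent hsymm ⟨x, hx1, x, hx2, Or.inl rfl⟩)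

/-- `∏_{γ ∈ Q} w γ = ∏_{D ∈ rcomponents inc Q} ∏_{γ ∈ D} w γ`. -/
theorem prod_eq_prod_rcomponents (hsymm : ∀ γ γ', inc γ γ' → inc γ' γ) (w : P → ℝ)
    (Q : Finset P) : ∏ γ ∈ Q, w γ = ∏ D ∈ rcomponents inc Q, ∏ γ ∈ D, w γ := by
  conv_lhs => rw [← biUnion_rcomponents (R := inc) Q]
  rw [Finset.prod_biUnion (pairwiseDisjoint_rcomponents hsymm Q)]
  simp only [id]

/-- FIRST EXIT: if `𝒦` is `inc`-connected and contains `γ₀`, every component of `𝒦.erase γ₀`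
contains some `γ` with `inc γ γ₀`. -/
theorem exists_inc_of_mem_rcomponents_erase {𝒦 : Finset P} (h𝒦 : IsRConnected inc 𝒦) {γ₀ : P}
    (hγ₀ : γ₀ ∈ 𝒦) {D : Finset P} (hD : D ∈ rcomponents inc (𝒦.erase γ₀)) :
    ∃ γ ∈ D, inc γ γ₀ := by
  obtain ⟨p, hp, rfl⟩ := mem_rcomponents_iff.1 hD
  by_contra hno
  push Not at hno
  -- every cell reachable from `p` inside `𝒦` stays in the component of `p` in `𝒦.erase γ₀`
  have hstay : ∀ q, Relation.ReflTransGen (fun x y => inc x y ∧ x ∈ 𝒦 ∧ y ∈ 𝒦) p q →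
      q ∈ rcomponent inc (𝒦.erase γ₀) p := by
    intro q hq
    induction hq with
    | refl => exact mem_rcomponent_self hp
    | @tail b c _ hbc ih =>
      obtain ⟨hinc, -, hc𝒦⟩ := hbc
      have hcne : c ≠ γ₀ := by
        rintro rfl
        exact hno b ih hinc
      have hcQ : c ∈ 𝒦.erase γ₀ := Finset.mem_erase.2 ⟨hcne, hc𝒦⟩
      obtain ⟨hbQ, hpb⟩ := mem_rcomponent.1 ih
      exact mem_rcomponent.2 ⟨hcQ, hpb.tail ⟨hinc, hbQ, hcQ⟩⟩
  have hp𝒦 : p ∈ 𝒦 := Finset.mem_of_mem_erase hp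
  have hγ₀D := hstay γ₀ (h𝒦.2 p hp𝒦 γ₀ hγ₀)
  have := rcomponent_subset (R := inc) (𝒦.erase γ₀) p hγ₀D
  simp at this

/-- THE ONE-STEP BOUND (no criterion needed; trivially true when `γ₀ ∉ Λ`): for `w ≥ 0`,
`S(Λ, γ₀) ≤ w γ₀ · exp (∑_{γ ∈ Λ.erase γ₀, inc γ γ₀} S(Λ.erase γ₀, γ))`, where
`S(Λ, γ) = ∑_{𝒦 ∈ rconnSubsets inc Λ, γ ∈ 𝒦} ∏_{γ' ∈ 𝒦} w γ'`. -/
theorem pinned_connected_sum_le_exp [DecidableRel inc] (hsymm : ∀ γ γ', inc γ γ' → inc γ' γ)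
    {w : P → ℝ} (hw : ∀ γ, 0 ≤ w γ) (Λ : Finset P) (γ₀ : P) :
    ∑ 𝒦 ∈ (rconnSubsets inc Λ).filter (fun 𝒦 => γ₀ ∈ 𝒦), ∏ γ ∈ 𝒦, w γ
      ≤ w γ₀ * Real.exp (∑ γ ∈ (Λ.erase γ₀).filter (fun γ => inc γ γ₀),
          ∑ 𝒦 ∈ (rconnSubsets inc (Λ.erase γ₀)).filter (fun 𝒦 => γ ∈ 𝒦), ∏ γ' ∈ 𝒦, w γ') := by
  classical
  set Λ' := Λ.erase γ₀ with hΛ'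
  set N := Λ'.filter (fun γ => inc γ γ₀) with hN
  -- the target family `A` and the weight `W`
  set A := (rconnSubsets inc Λ').filter (fun D => ∃ γ ∈ D, inc γ γ₀) with hA
  set W : Finset P → ℝ := fun D => ∏ γ ∈ D, w γ with hW
  have hW0 : ∀ D, 0 ≤ W D := fun D => prod_weight_nonneg hw D
  set src := (rconnSubsets inc Λ).filter (fun 𝒦 => γ₀ ∈ 𝒦) with hsrc
  set Φ : Finset P → Finset (Finset P) := fun 𝒦 => rcomponents inc (𝒦.erase γ₀) with hΦ
  -- (1) factor `w γ₀` and regroup over components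
  have hstep1 : ∀ 𝒦 ∈ src, ∏ γ ∈ 𝒦, w γ = w γ₀ * ∏ D ∈ Φ 𝒦, W D := by
    intro 𝒦 h𝒦
    have hγ₀𝒦 : γ₀ ∈ 𝒦 := (Finset.mem_filter.1 h𝒦).2
    rw [← Finset.mul_prod_erase 𝒦 w hγ₀𝒦, prod_eq_prod_rcomponents hsymm w (𝒦.erase γ₀)]
  -- (2) `Φ` maps into the powerset of `A`
  have hmaps : ∀ 𝒦 ∈ src, Φ 𝒦 ∈ A.powerset := by
    intro 𝒦 h𝒦
    obtain ⟨h𝒦Λ, hγ₀𝒦⟩ := Finset.mem_filter.1 h𝒦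
    obtain ⟨h𝒦sub, h𝒦conn⟩ := mem_rconnSubsets.1 h𝒦Λ
    rw [Finset.mem_powerset]
    intro D hD
    rw [hA, Finset.mem_filter, mem_rconnSubsets]
    obtain ⟨p, hp, hpD⟩ := mem_rcomponents_iff.1 hD
    refine ⟨⟨?_, ?_⟩, exists_inc_of_mem_rcomponents_erase h𝒦conn hγ₀𝒦 hD⟩
    · rw [← hpD]
      exact (rcomponent_subset _ p).trans (Finset.erase_subset_erase γ₀ h𝒦sub)
    · rw [← hpD]
      exact isRConnected_rcomponent hsymm hp
  -- (3) `Φ` is injective on `src`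
  have hinj : Set.InjOn Φ ↑src := by
    intro 𝒦₁ h₁ 𝒦₂ h₂ heq
    have hγ₁ : γ₀ ∈ 𝒦₁ := (Finset.mem_filter.1 (Finset.mem_coe.1 h₁)).2
    have hγ₂ : γ₀ ∈ 𝒦₂ := (Finset.mem_filter.1 (Finset.mem_coe.1 h₂)).2
    have h1 := biUnion_rcomponents (R := inc) (𝒦₁.erase γ₀)
    have h2 := biUnion_rcomponents (R := inc) (𝒦₂.erase γ₀)
    have : 𝒦₁.erase γ₀ = 𝒦₂.erase γ₀ := by
      rw [← h1, ← h2]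
      exact congrArg (fun 𝒳 => Finset.biUnion 𝒳 id) heq
    rw [← Finset.insert_erase hγ₁, ← Finset.insert_erase hγ₂, this]
  -- (4) the chain of inequalities
  have hsum_src : ∑ 𝒦 ∈ src, ∏ γ ∈ 𝒦, w γ = w γ₀ * ∑ 𝒦 ∈ src, ∏ D ∈ Φ 𝒦, W D := by
    rw [Finset.mul_sum]
    exact Finset.sum_congr rfl hstep1
  have himage : ∑ 𝒦 ∈ src, ∏ D ∈ Φ 𝒦, W D = ∑ ℱ ∈ src.image Φ, ∏ D ∈ ℱ, W D := by
    rw [Finset.sum_image]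
    intro x hx y hy h
    exact hinj (Finset.mem_coe.2 hx) (Finset.mem_coe.2 hy) h
  have hsub : src.image Φ ⊆ A.powerset := by
    intro ℱ hℱ
    obtain ⟨𝒦, h𝒦, rfl⟩ := Finset.mem_image.1 hℱ
    exact hmaps 𝒦 h𝒦
  have hle_pow : ∑ ℱ ∈ src.image Φ, ∏ D ∈ ℱ, W D ≤ ∑ ℱ ∈ A.powerset, ∏ D ∈ ℱ, W D :=
    Finset.sum_le_sum_of_subset_of_nonneg hsub fun ℱ _ _ => Finset.prod_nonneg fun D _ => hW0 D
  have hprod : ∑ ℱ ∈ A.powerset, ∏ D ∈ ℱ, W D = ∏ D ∈ A, (1 + W D) :=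
    (Finset.prod_one_add A).symm
  have hexp : ∏ D ∈ A, (1 + W D) ≤ Real.exp (∑ D ∈ A, W D) :=
    prod_one_add_le_exp_sum A W fun D _ => hW0 D
  -- (5) `∑_{D ∈ A} W D ≤ ∑_{γ ∈ N} S(Λ', γ)` by the covering lemma
  have hcover : ∑ D ∈ A, W D ≤
      ∑ γ ∈ N, ∑ D ∈ (rconnSubsets inc Λ') with γ ∈ D, W D := by
    refine sum_le_sum_sum_filter_of_cover A (rconnSubsets inc Λ') N (fun γ D => γ ∈ D) W
      (fun D _ => hW0 D) (Finset.filter_subset _ _) ?_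
    intro D hD
    obtain ⟨hDconn, γ, hγD, hγinc⟩ := Finset.mem_filter.1 hD
    refine ⟨γ, ?_, hγD⟩
    rw [hN, Finset.mem_filter]
    exact ⟨(mem_rconnSubsets.1 hDconn).1 hγD, hγinc⟩
  -- assemble
  rw [hsum_src, himage]
  refine mul_le_mul_of_nonneg_left ?_ (hw γ₀)
  calc ∑ ℱ ∈ src.image Φ, ∏ D ∈ ℱ, W D
      ≤ ∑ ℱ ∈ A.powerset, ∏ D ∈ ℱ, W D := hle_pow
    _ = ∏ D ∈ A, (1 + W D) := hprod
    _ ≤ Real.exp (∑ D ∈ A, W D) := hexp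
    _ ≤ Real.exp (∑ γ ∈ N, ∑ D ∈ (rconnSubsets inc Λ') with γ ∈ D, W D) :=
        Real.exp_le_exp.2 hcover

/-! ## §3 The pinned bound by induction on the volume -/

/-- **PINNED CONNECTED-SUBFAMILY SUM under the Kotecký–Preiss criterion.**  For a reflexive
symmetric incompatibility `inc`, weights `w ≥ 0` and a size function `a` with
`∀ γ ∈ Λ, ∑_{γ' ∈ Λ, inc γ' γ} w γ' e^{a γ'} ≤ a γ`: for every `γ₀ ∈ Λ`,
`∑_{𝒦 ∈ rconnSubsets inc Λ, γ₀ ∈ 𝒦} ∏_{γ ∈ 𝒦} w γ ≤ w γ₀ · e^{a γ₀}`.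
[cite: KoteckyPreiss1986, §2] [cite: FriedliVelenik2017, §5.4] -/
theorem pinned_connected_sum_le [DecidableRel inc] (hrefl : ∀ γ, inc γ γ)
    (hsymm : ∀ γ γ', inc γ γ' → inc γ' γ) {w a : P → ℝ} (hw : ∀ γ, 0 ≤ w γ) :
    ∀ (Λ : Finset P), (∀ γ ∈ Λ, ∑ γ' ∈ Λ with inc γ' γ, w γ' * Real.exp (a γ') ≤ a γ) →
      ∀ γ₀ ∈ Λ, ∑ 𝒦 ∈ (rconnSubsets inc Λ).filter (fun 𝒦 => γ₀ ∈ 𝒦), ∏ γ ∈ 𝒦, w γ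
        ≤ w γ₀ * Real.exp (a γ₀) := by
  have _ := hrefl
  -- induction on the cardinality of the volume
  suffices h : ∀ (n : ℕ) (Λ : Finset P), Λ.card = n →
      (∀ γ ∈ Λ, ∑ γ' ∈ Λ with inc γ' γ, w γ' * Real.exp (a γ') ≤ a γ) →
      ∀ γ₀ ∈ Λ, ∑ 𝒦 ∈ (rconnSubsets inc Λ).filter (fun 𝒦 => γ₀ ∈ 𝒦), ∏ γ ∈ 𝒦, w γ
        ≤ w γ₀ * Real.exp (a γ₀) from fun Λ => h Λ.card Λ rfl
  intro n
  induction n with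
  | zero =>
    intro Λ hcard _ γ₀ hγ₀
    rw [Finset.card_eq_zero] at hcard
    subst hcard
    simp at hγ₀
  | succ n ih =>
    intro Λ hcard hKP γ₀ hγ₀
    set Λ' := Λ.erase γ₀ with hΛ'
    have hcard' : Λ'.card = n := by
      rw [hΛ', Finset.card_erase_of_mem hγ₀, hcard]; rfl
    -- the criterion is inherited by `Λ'`
    have hKP' : ∀ γ ∈ Λ', ∑ γ' ∈ Λ' with inc γ' γ, w γ' * Real.exp (a γ') ≤ a γ := by
      intro γ hγ
      refine le_trans ?_ (hKP γ (Finset.mem_of_mem_erase hγ))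
      exact Finset.sum_le_sum_of_subset_of_nonneg
        (Finset.filter_subset_filter _ (Finset.erase_subset γ₀ Λ))
        fun γ' _ _ => mul_nonneg (hw γ') (Real.exp_nonneg _)
    have hIH := ih Λ' hcard' hKP'
    -- one step, then the inductive bound, then the criterion at `γ₀`
    refine (pinned_connected_sum_le_exp hsymm hw Λ γ₀).trans ?_
    refine mul_le_mul_of_nonneg_left (Real.exp_le_exp.2 ?_) (hw γ₀)
    calc ∑ γ ∈ Λ'.filter (fun γ => inc γ γ₀),
          ∑ 𝒦 ∈ (rconnSubsets inc Λ').filter (fun 𝒦 => γ ∈ 𝒦), ∏ γ' ∈ 𝒦, w γ'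
        ≤ ∑ γ ∈ Λ'.filter (fun γ => inc γ γ₀), w γ * Real.exp (a γ) :=
          Finset.sum_le_sum fun γ hγ => hIH γ (Finset.mem_filter.1 hγ).1
      _ ≤ ∑ γ' ∈ Λ with inc γ' γ₀, w γ' * Real.exp (a γ') :=
          Finset.sum_le_sum_of_subset_of_nonneg
            (Finset.filter_subset_filter _ (Finset.erase_subset γ₀ Λ))
            fun γ' _ _ => mul_nonneg (hw γ') (Real.exp_nonneg _)
      _ ≤ a γ₀ := hKP γ₀ hγ₀

/-! ## §4 The sketch's `Prop`, by text -/

/-- **`PinnedConnectedFamilyBound` of `Cruxes/FluctuationComparisonRegPrIntL/EPrimeSketch.lean`,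
UNFOLDED TOKEN FOR TOKEN** (E′-COMB of crux idea `neumann-frd-step`): for a reflexive symmetric
incompatibility `inc` on `P`, weights `w ≥ 0` and a size function `a` satisfying the (real,
finite-volume) Kotecký–Preiss criterion on `Λ`, the sum over the `inc`-connected subfamilies of `Λ`
pinned at `γ₀` of the weight products is at most `w γ₀ · e^{a γ₀}`.  A line importing this file
closes the sketch's `PinnedConnectedFamilyBound` by `:= pinnedConnectedFamilyBound`.
[cite: KoteckyPreiss1986, §2] [cite: FriedliVelenik2017, §5.4] -/
theorem pinnedConnectedFamilyBound :
    ∀ (P : Type) [DecidableEq P] (inc : P → P → Prop) [DecidableRel inc] (w a : P → ℝ) (Λ : Finset P),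
    (∀ γ, inc γ γ) → (∀ γ γ', inc γ γ' → inc γ' γ) → (∀ γ, 0 ≤ w γ) →
    (∀ γ ∈ Λ, ∑ γ' ∈ Λ with inc γ' γ, w γ' * Real.exp (a γ') ≤ a γ) →
    ∀ γ₀ ∈ Λ, ∑ 𝒦 ∈ (rconnSubsets inc Λ).filter (fun 𝒦 => γ₀ ∈ 𝒦), ∏ γ ∈ 𝒦, w γ
      ≤ w γ₀ * Real.exp (a γ₀) := by
  intro P _ inc _ w a Λ hrefl hsymm hw hKP
  exact pinned_connected_sum_le hrefl hsymm hw Λ hKP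

end Summit.QuantumFields.YangMills.Theorems.FluctuationComparisonRegPrIntLS2BetaEPrimeComb
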